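import Mathlib.Combinatorics.SetFamily.FourFunctions
import Mathlib.Order.Hom.Lattice
import Literature.Combinatorics.Sahi2008.PushForward
import Literature.Combinatorics.Sahi2008.ProvedCases
import HarnessLib

/-!
# Marginals of FKG weights are FKG (Karlin–Rinott 1980, (1.15)–(1.16) and Prop. 3.2, finite case)

CITATION HEADER.  Source: S. Karlin, Y. Rinott, *Classes of orderings of measures and related
correlation inequalities. I. Multivariate totally positive distributions*, J. Multivariate Anal. **10**
(1980) 467–498 [KarlinRinott1980], held text `paper:doi-10-1016-0047-259x-80-90065-2` (read
2026-08-19, pp. 1–5 of the materialised text = pp. 467–481).  Verbatim (p. 468, (1.15)–(1.16)):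
"Composition formula.  Suppose `f(x, y)` is MTP₂ over `𝒳 × 𝒴` and `g(y, z)` is MTP₂ over `𝒴 × 𝒵` …
then `h(x, z) = ∫ f(x, y) g(y, z) dy` is MTP₂ over `𝒳 × 𝒵`.  (1.15)  A useful consequence of (1.15)
concerns marginal densities.  Accordingly, if `X = (X₁, X₂, …, X_n)` is MTP₂, then any subset, say for
definiteness, `X_k = (X₁, X₂, …, X_k)` is also MTP₂ (`2 ≤ k ≤ n`).  (1.16)"; §3, Prop. 3.2 (p. 481)
restates (1.16); the proof of Thm. 2.1 (p. 471) is the mechanism: "if `f₁, f₂, f₃, f₄` satisfy (2.1),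
then the (marginals) functions `φⱼ(x) = ∫ fⱼ(x, 𝓍) dσ_n(𝓍)`, `j = 1, 2, 3, 4`, … continue to satisfy (2.1)"
— i.e. the four functions theorem of Ahlswede–Daykin [AhlswedeDaykin1978] (Mathlib
`four_functions_theorem_univ`).  Setting of the paper (§2, p. 470): `𝒳 = ∏ᵢ 𝒳ᵢ` a product of totally
ordered spaces with a product measure `σ = σ₁ × ⋯ × σ_n`; here the FINITE case (finite chains, counting
measure), in the vocabulary of the Sahi programme (`IsFKGMeasure`, `pushWeight` of
`Sahi2008/Functional.lean`, `Sahi2008/PushForward.lean`).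

## What is proved (all `theorem`s; no named fact)

* `fkgCondition_pushWeight` — the FKG lattice condition `μ(a)μ(b) ≤ μ(a ⊓ b)μ(a ⊔ b)` of a nonnegative
  weight on a finite distributive lattice `β` passes to its push-forward along ANY map `G : β → γ` into a
  lattice that preserves `⊓` and `⊔` (one application of the four functions theorem on `β` to
  `μ·1_{G = c}, μ·1_{G = d}, μ·1_{G = c ⊓ d}, μ·1_{G = c ⊔ d}`).  The print states the coordinate-projection
  case (products of chains); the lattice-homomorphism form is the same Ahlswede–Daykin step and is what
  the tree's `pushWeight` wants — labelled as such (no claim that [KarlinRinott1980] prints it in this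
  generality).
* `IsFKGMeasure.pushWeight_latticeHom` — hence the push-forward of an FKG probability weight along a
  lattice homomorphism is an FKG probability weight; special cases `IsFKGMeasure.pushWeight_fst/_snd`
  (product lattice `β × γ`, Karlin–Rinott's "any subset of coordinates" for two blocks),
  `IsFKGMeasure.pushWeight_precomp` (restriction `ω ↦ ω ∘ e` of `ι → α` to the coordinates in the range of
  `e : κ → ι` — (1.16)/Prop. 3.2 verbatim for finite chains `α`), `IsFKGMeasure.pushWeight_inter`
  (`2^X → 2^X`, `S ↦ S ∩ T`, whose law is the marginal on the coordinates in `T`).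
* `sahiE_comp_nonneg_of_forall_isFKGMeasure` — CONSEQUENCE FOR SAHI'S HIERARCHY (plumbing, by
  `sahiE_pushWeight` = [Kahn2022, p. 2 "underlying independents"] for every order): if Sahi positivity of
  order `n` holds for EVERY FKG weight on the target lattice `γ`, then for every FKG weight `μ` on a finite
  distributive lattice `β`, every lattice homomorphism `G : β → γ` and all nonnegative monotone
  `f₀,…,f_{n-1} : γ → ℝ`, `E_n^μ(f₀ ∘ G, …, f_{n-1} ∘ G) ≥ 0`.  With Sahi's Prop. 15
  (`SahiTwoPointLatticeTheorem_holds`, `|X| ≤ 2`, every `n`) this gives `E_n ≥ 0` for functions of an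
  arbitrary FKG weight that factor through a lattice homomorphism to `2^X`, `|X| ≤ 2` — recorded below as an
  `example` only (a new corollary is Summits-side material under the placement rule; the Sahi cell's
  typer is told).

Relevance (crux `stmt-CriticalPhenomena-4575`, Sahi cell): Sahi's Conjecture `C_n` quantifies over all
FKG weights; the marginal closure reduces `C_n` for functions depending on a set `T` of coordinates of
`{0,1}^ι` under an ARBITRARY FKG weight (e.g. a ferromagnetic Ising measure) to `C_n` on `{0,1}^T` for
all FKG weights there — proved in the tree for `|T| ≤ 2`, all `n` (Prop. 15) and for `|T| = 3`, `n = 3`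
(Summits-side `SahiC3Cube.latticeE3_nonneg_cube_three`).  The continuous named fact
`Literature.Probability.LatticeModels.KarlinRinott1980_prop_3_2` (`MTP2FKG.lean`, densities on `ℝⁿ`) is
a different rendering of the same printed statement and is not used here.
-/

namespace Literature.Combinatorics.Sahi2008

open Finset

/-! ### The four-functions step: the FKG lattice condition passes to push-forwards along lattice maps -/

section LatticeMap

variable {β γ : Type*} [Fintype β] [DistribLattice β] [Lattice γ]

/-- `0 ≤ (if p then x else 0)` for `0 ≤ x`. [folklore] -/
private theorem ite_nonneg_of_nonneg {p : Prop} [Decidable p] {x : ℝ} (hx : 0 ≤ x) :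
    0 ≤ (if p then x else 0) := by
  split_ifs
  · exact hx
  · exact le_rfl

/-- **The FKG lattice condition passes to the push-forward along a map preserving `⊓` and `⊔`**
(Karlin–Rinott 1980, (1.15)–(1.16) / Prop. 3.2, finite case; mechanism = the four functions theorem of
Ahlswede–Daykin applied on `β` to `μ·1_{G=c}`, `μ·1_{G=d}`, `μ·1_{G=c⊓d}`, `μ·1_{G=c⊔d}`): for a
nonnegative log-supermodular weight `μ` on a finite distributive lattice `β` and `G : β → γ` with
`G(a ⊓ b) = G a ⊓ G b`, `G(a ⊔ b) = G a ⊔ G b`, the law `G_* μ` is log-supermodular on `γ`.  (Printed for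
coordinate projections of products of totally ordered spaces; the lattice-map form is the same step.)
[cite: KarlinRinott1980, (1.15)–(1.16) and Prop. 3.2] [cite: AhlswedeDaykin1978, Thm. 1] -/
theorem fkgCondition_pushWeight {μ : β → ℝ} (hμ0 : ∀ b, 0 ≤ μ b)
    (hμ : ∀ a b, μ a * μ b ≤ μ (a ⊓ b) * μ (a ⊔ b)) {G : β → γ}
    (hinf : ∀ a b, G (a ⊓ b) = G a ⊓ G b) (hsup : ∀ a b, G (a ⊔ b) = G a ⊔ G b) (c d : γ) :
    pushWeight μ G c * pushWeight μ G d ≤ pushWeight μ G (c ⊓ d) * pushWeight μ G (c ⊔ d) := by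
  classical
  simp only [pushWeight_apply]
  refine four_functions_theorem_univ (fun b => if G b = c then μ b else 0)
    (fun b => if G b = d then μ b else 0) (fun b => if G b = c ⊓ d then μ b else 0)
    (fun b => if G b = c ⊔ d then μ b else 0) (fun b => ite_nonneg_of_nonneg (hμ0 b))
    (fun b => ite_nonneg_of_nonneg (hμ0 b)) (fun b => ite_nonneg_of_nonneg (hμ0 b))
    (fun b => ite_nonneg_of_nonneg (hμ0 b)) fun a b => ?_
  by_cases ha : G a = c
  · by_cases hb : G b = d
    · have h1 : G (a ⊓ b) = c ⊓ d := by rw [hinf, ha, hb]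
      have h2 : G (a ⊔ b) = c ⊔ d := by rw [hsup, ha, hb]
      rw [if_pos ha, if_pos hb, if_pos h1, if_pos h2]
      exact hμ a b
    · rw [if_neg hb, mul_zero]
      exact mul_nonneg (ite_nonneg_of_nonneg (hμ0 _)) (ite_nonneg_of_nonneg (hμ0 _))
  · rw [if_neg ha, zero_mul]
    exact mul_nonneg (ite_nonneg_of_nonneg (hμ0 _)) (ite_nonneg_of_nonneg (hμ0 _))

variable [Fintype γ]

/-- **Push-forwards of FKG probability weights along maps preserving `⊓`, `⊔` are FKG probability
weights** (Karlin–Rinott 1980, Prop. 3.2, finite case, in the tree's `IsFKGMeasure`/`pushWeight`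
vocabulary). [cite: KarlinRinott1980, (1.15)–(1.16) and Prop. 3.2] -/
theorem IsFKGMeasure.pushWeight_of_map_inf_sup {μ : β → ℝ} (hμ : IsFKGMeasure μ) {G : β → γ}
    (hinf : ∀ a b, G (a ⊓ b) = G a ⊓ G b) (hsup : ∀ a b, G (a ⊔ b) = G a ⊔ G b) :
    IsFKGMeasure (pushWeight μ G) where
  nonneg c := pushWeight_nonneg hμ.nonneg G c
  sum_eq_one := by rw [sum_pushWeight, hμ.sum_eq_one]
  mul_le_mul c d := fkgCondition_pushWeight hμ.nonneg hμ.mul_le_mul hinf hsup c d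

/-- **Push-forwards of FKG probability weights along lattice homomorphisms are FKG** (Karlin–Rinott
1980, Prop. 3.2, finite case; `LatticeHom` form). [cite: KarlinRinott1980, (1.15)–(1.16) and Prop. 3.2] -/
theorem IsFKGMeasure.pushWeight_latticeHom {μ : β → ℝ} (hμ : IsFKGMeasure μ) (G : LatticeHom β γ) :
    IsFKGMeasure (pushWeight μ G) :=
  hμ.pushWeight_of_map_inf_sup (map_inf G) (map_sup G)

end LatticeMap

/-! ### Coordinate marginals (the printed form: "any subset of an MTP₂ vector is MTP₂") -/

section Coordinates

/-- **First-block marginal**: the law of the first coordinate block of an FKG weight on a product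
lattice `β × γ` is FKG (Karlin–Rinott (1.16): "if `X = (X₁,…,X_n)` is MTP₂, then any subset … is also
MTP₂"). [cite: KarlinRinott1980, (1.16) and Prop. 3.2] -/
theorem IsFKGMeasure.pushWeight_fst {β γ : Type*} [Fintype β] [Fintype γ] [DistribLattice β]
    [DistribLattice γ] {μ : β × γ → ℝ} (hμ : IsFKGMeasure μ) :
    IsFKGMeasure (pushWeight μ Prod.fst) :=
  hμ.pushWeight_latticeHom LatticeHom.fst

/-- **Second-block marginal** (as `IsFKGMeasure.pushWeight_fst`). [cite: KarlinRinott1980, (1.16) and Prop. 3.2] -/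
theorem IsFKGMeasure.pushWeight_snd {β γ : Type*} [Fintype β] [Fintype γ] [DistribLattice β]
    [DistribLattice γ] {μ : β × γ → ℝ} (hμ : IsFKGMeasure μ) :
    IsFKGMeasure (pushWeight μ Prod.snd) :=
  hμ.pushWeight_latticeHom LatticeHom.snd

/-- **Sub-vector marginals on a product of finite chains / finite distributive lattices**: for an FKG
weight `μ` on `ι → α` and any re-indexing `e : κ → ι` (an injection `e` picks out the coordinates in its
range), the law of `ω ↦ ω ∘ e` is FKG on `κ → α` — Karlin–Rinott's Prop. 3.2 "`(X₁,…,X_k)` is also MTP₂"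
for finite totally ordered (more generally distributive) coordinate spaces with counting measure.
[cite: KarlinRinott1980, (1.16) and Prop. 3.2] -/
theorem IsFKGMeasure.pushWeight_precomp {ι κ α : Type*} [Fintype ι] [Fintype κ] [DecidableEq ι]
    [DecidableEq κ] [Fintype α] [DistribLattice α] {μ : (ι → α) → ℝ} (hμ : IsFKGMeasure μ) (e : κ → ι) :
    IsFKGMeasure (pushWeight μ fun ω : ι → α => ω ∘ e) :=
  hμ.pushWeight_of_map_inf_sup (fun _ _ => rfl) (fun _ _ => rfl)

/-- **Marginal on a set of coordinates of `2^X`**: for an FKG weight `μ` on `Finset X` (Sahi's `2^X`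
[Sahi2008, p. 210]) and `T ⊆ X`, the law of `S ↦ S ∩ T` (the configuration seen on the coordinates in
`T`) is FKG. [cite: KarlinRinott1980, (1.16) and Prop. 3.2] -/
theorem IsFKGMeasure.pushWeight_inter {X : Type*} [Fintype X] [DecidableEq X] {μ : Finset X → ℝ}
    (hμ : IsFKGMeasure μ) (T : Finset X) : IsFKGMeasure (pushWeight μ fun S => S ∩ T) :=
  hμ.pushWeight_of_map_inf_sup (fun a b => inf_inf_distrib_right a b T)
    (fun a b => union_inter_distrib_right a b T)

end Coordinates

/-! ### Consequence for Sahi's functionals: `C_n` for functions factoring through a lattice map -/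

section Sahi

variable {β γ : Type*} [Fintype β] [Fintype γ] [Lattice γ]

/-- **Sahi positivity of the push-forward gives `E_n ≥ 0` for the pulled-back family** (the functional
only sees expectations of products, `sahiE_pushWeight`). [cite: Kahn2022, p. 2 (Underlying independents); LiebSahi2021, Def. 3.1 and Prop. 3.3] -/
theorem sahiE_comp_nonneg_of_sahiPositive_pushWeight {μ : β → ℝ} {G : β → γ} {n : ℕ}
    (h : SahiPositive (pushWeight μ G) n) (f : Fin n → γ → ℝ) (hf0 : ∀ i c, 0 ≤ f i c)
    (hmono : ∀ i, Monotone (f i)) : 0 ≤ sahiE μ n fun i => f i ∘ G := by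
  rw [← sahiE_pushWeight]
  exact h f hf0 hmono

variable [DistribLattice β]

/-- **`C_n` for functions that factor through a lattice homomorphism** (Karlin–Rinott Prop. 3.2 ∘ the
definition of Sahi positivity): if `E_n ≥ 0` holds for EVERY FKG probability weight on the lattice `γ`
(e.g. `γ = 2^X` with `|X| ≤ 2`, Sahi's Prop. 15), then for every FKG probability weight `μ` on a finite
distributive lattice `β`, every lattice homomorphism `G : β → γ` and all nonnegative monotone
`f₀,…,f_{n−1} : γ → ℝ`, `E_n^μ(f₀ ∘ G,…,f_{n−1} ∘ G) ≥ 0`. [cite: KarlinRinott1980, (1.16) and Prop. 3.2] [cite: Kahn2022, p. 2 (Underlying independents)] -/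
theorem sahiE_comp_nonneg_of_forall_isFKGMeasure {μ : β → ℝ} (hμ : IsFKGMeasure μ)
    (G : LatticeHom β γ) {n : ℕ} (hγ : ∀ ν : γ → ℝ, IsFKGMeasure ν → SahiPositive ν n)
    (f : Fin n → γ → ℝ) (hf0 : ∀ i c, 0 ≤ f i c) (hmono : ∀ i, Monotone (f i)) :
    0 ≤ sahiE μ n fun i => f i ∘ G :=
  sahiE_comp_nonneg_of_sahiPositive_pushWeight (hγ _ (hμ.pushWeight_latticeHom G)) f hf0 hmono

/-- With Sahi's Prop. 15 (`SahiTwoPointLatticeTheorem_holds`): for EVERY FKG probability weight `μ` on a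
finite distributive lattice and every lattice homomorphism `G` to `2^X` with `|X| ≤ 2`, all orders `n`:
`E_n^μ(f₀ ∘ G,…,f_{n−1} ∘ G) ≥ 0` for nonnegative monotone `fᵢ : 2^X → ℝ` (e.g. functions of two fixed
coordinates of `{0,1}^ι` under a ferromagnetic Ising weight).  Recorded as an example only. -/
example {μ : β → ℝ} (hμ : IsFKGMeasure μ) {X : Type} [Fintype X] (hX : Fintype.card X ≤ 2)
    (G : LatticeHom β (Set X)) (n : ℕ) (f : Fin n → Set X → ℝ) (hf0 : ∀ i c, 0 ≤ f i c)
    (hmono : ∀ i, Monotone (f i)) : 0 ≤ sahiE μ n fun i => f i ∘ G :=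
  sahiE_comp_nonneg_of_forall_isFKGMeasure hμ G
    (fun ν hν => SahiTwoPointLatticeTheorem_holds X hX ν hν n) f hf0 hmono

end Sahi

end Literature.Combinatorics.Sahi2008
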